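import Literature.NumberTheory.Waring.ElementaryBounds
import Literature.NumberTheory.Waring.ThirteenCubes
import Literature.NumberTheory.Waring.SixthAndEighthPowers
import HarnessLib

/-!
# Waring's problem: `g(6) ≤ 2451` and `g(8) ≤ 42273` (Hardy–Wright, Theorems 391 and 392)

Topic `Literature/NumberTheory/Waring`, namespace `Literature.NumberTheory.Waring`. The numerical
halves of Hardy–Wright's Theorems 391–392, obtained by feeding Theorem 390 (`g(3) ≤ 13`,
`ThirteenCubes.lean`) and Theorem 387 (`g(4) ≤ 50`, `ElementaryBounds.lean`) into the structural
inequalities `g(6) ≤ 184 g(3) + 59`, `g(8) ≤ 840 g(4) + 273` of `SixthAndEighthPowers.lean`.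
Theorems only.

> «THEOREM 391: g(6) ≤ 184g(3) + 59 ≤ 2451. … THEOREM 392: g(8) ≤ 840g(4) + 273 ≤ 42273.»
> (G. H. Hardy, E. M. Wright, *An Introduction to the Theory of Numbers*, 6th ed. (2008), §21.4.)

## References

* G. H. Hardy, E. M. Wright, *An Introduction to the Theory of Numbers*, 6th ed., OUP (2008),
  §21.4 Theorems 391, 392. [HardyWright2008]
-/

namespace Literature.NumberTheory.Waring

/-- **Hardy–Wright Theorem 391: `g(6) ≤ 2451`** — every `n` is a sum of at most `2451 = 184·13 + 59`
sixth powers. [cite: HardyWright2008, §21.4 Theorem 391] -/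
theorem exists_sum_sixth_powers (n : ℕ) :
    ∃ l : List ℕ, l.length ≤ 2451 ∧ (l.map (· ^ 6)).sum = n :=
  exists_sum_sixth_powers_of_sum_cubes (s := 13) exists_sum_thirteen_cubes n

/-- **Hardy–Wright Theorem 392: `g(8) ≤ 42273`** — every `n` is a sum of at most
`42273 = 840·50 + 273` eighth powers. [cite: HardyWright2008, §21.4 Theorem 392] -/
theorem exists_sum_eighth_powers (n : ℕ) :
    ∃ l : List ℕ, l.length ≤ 42273 ∧ (l.map (· ^ 8)).sum = n :=
  exists_sum_eighth_powers_of_sum_biquadrates (t := 50) exists_length_le_fifty n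

end Literature.NumberTheory.Waring
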